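import Literature.NumberTheory.LFunctions.MoebiusAutomaticFourierContraction
import Literature.NumberTheory.LFunctions.MoebiusAutomaticCarry
import Literature.NumberTheory.LFunctions.MauduitRivatFourier
import Mathlib.Analysis.SpecialFunctions.Log.Base
import HarnessLib

/-!
# Müllner's Fourier estimate: Lemma 4.7, Prop. 4.6 and Thm. 4.5 of Müllner 2017 (proved)

Everything in this file is PROVED (plus plain definitions). It completes §4.1 of C. Müllner,
*Automatic sequences fulfill the Sarnak conjecture*, Duke Math. J. 166 (2017) (= arXiv:1602.03042)
in the representation-free form of `MoebiusAutomaticFourierContraction.lean` (any base-`k`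
automaton with `d(A) = k₀(A) = 1`, any relabelling `ρ` of its naturally induced transducer, any
finite-dimensional unitary representation `A` of `Perm (Fin n₀)`, the good subspaces
`MinImage.goodSubspace`):

* `MinImage.psiSum k A ρ N λ tail t y = ∑_{u<k^λ} e(−ut) · A(T̄(N, (u)_k^λ tail)) y` — Müllner's
  `ψ^q_{λ,α}(t, r)` (with the fixed suffix `tail = (r)_k^α`), applied to a vector;
* **Lemma 4.7** `MinImage.psiSum_add` — the recursion over the `m` most significant digits;
* **Prop. 4.6 / Thm. 4.5** `MinImage.norm_psiSum_le_pow`, `MinImage.exists_fourier_decay`: with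
  the block length `m` and the gap `η` of `MinImage.exists_loopSum_contraction`,
  `‖ψ^N_λ y‖ ≤ k^λ (1 − η/k^m)^{⌊λ/m⌋} ‖y‖ ≤ C k^λ k^{−θλ} ‖y‖` for every state `N`, suffix,
  real `t` and good vector `y` — exponential decay, uniformly;
* **Def. 4.2 for the transducer** `MinImage.exists_fourier_decay_digits`,
  `MinImage.hasFourierProperty_Tρ`: for a ZERO-STABLE state `M` (`δ(M,0) = M`, `T(M,0) = id`) the
  vector sequence `n ↦ A(T̄(M, (n)_k)) y`, `y` good, satisfies
  `‖k^{-λ} ∑_{u<k^λ} e(−ut) A(T̄(M,(u k^α)_k)) y‖ ≤ C k^{−θλ} ‖y‖` for ALL `α` (Müllner needs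
  `α ≤ cλ` only for the shift `r`, absent here), i.e. it lies in the class `F_{γ,c}` of
  `MauduitRivat.HasFourierProperty` with `γ(λ) = θλ − log_k C` and every `c`.

## References
* C. Müllner, Duke Math. J. 166 (2017) 3219–3290 = arXiv:1602.03042: Def. 4.2, Thm. 4.5,
  Prop. 4.6, Lemma 4.7 (pp. 19–20). [Mullner2017]
-/

noncomputable section

open Finset Complex
open scoped FourierTransform InnerProductSpace

namespace Literature.NumberTheory.LFunctions

/-- A sum over `i < B L` in `B` blocks of `L` consecutive indices. [folklore] -/
theorem sum_range_mul_blocks {M : Type*} [AddCommMonoid M] (f : ℕ → M) (B L : ℕ) :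
    ∑ i ∈ range (B * L), f i = ∑ b ∈ range B, ∑ s ∈ range L, f (b * L + s) := by
  induction B with
  | zero => simp
  | succ B ih => rw [Nat.succ_mul, Finset.sum_range_add, ih, Finset.sum_range_succ]

namespace MinImage

variable {σ : Type*} [Fintype σ] [DecidableEq σ] {δ : σ → ℕ → σ} {k : ℕ}
variable {V : Type*} [NormedAddCommGroup V] [InnerProductSpace ℂ V]

/-! ## Müllner's `ψ` -/

/-- Müllner's `ψ^q_{λ,α}(t, r)` with a fixed suffix, applied to a vector:
`ψ^N_λ(tail, t) y = ∑_{u<k^λ} e(−ut) · A(T̄(N, (u)_k^λ tail)) y`. [cite: Mullner2017, §4.1 (definition of ψ)] -/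
def psiSum (k : ℕ) (A : Equiv.Perm (Fin (minRank δ)) →* (V →ₗ[ℂ] V))
    (ρ : MinImage δ → Equiv.Perm (Fin (minRank δ))) (N : MinImage δ) (lam : ℕ) (tail : List ℕ)
    (t : ℝ) (y : V) : V :=
  ∑ u ∈ range (k ^ lam), ((𝐞 (-((u : ℝ) * t)) : Circle) : ℂ) • A (N.Tρ ρ (msbBlock k lam u ++ tail)) y

/-- `ψ` is additive in the vector. [folklore] -/
theorem psiSum_add_vec (A : Equiv.Perm (Fin (minRank δ)) →* (V →ₗ[ℂ] V))
    (ρ : MinImage δ → Equiv.Perm (Fin (minRank δ))) (N : MinImage δ) (lam : ℕ) (tail : List ℕ)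
    (t : ℝ) (y y' : V) :
    N.psiSum k A ρ lam tail t (y + y') = N.psiSum k A ρ lam tail t y + N.psiSum k A ρ lam tail t y' := by
  simp only [psiSum, map_add, smul_add, sum_add_distrib]

/-- `ψ` is homogeneous in the vector. [folklore] -/
theorem psiSum_smul (A : Equiv.Perm (Fin (minRank δ)) →* (V →ₗ[ℂ] V))
    (ρ : MinImage δ → Equiv.Perm (Fin (minRank δ))) (N : MinImage δ) (lam : ℕ) (tail : List ℕ)
    (t : ℝ) (c : ℂ) (y : V) :
    N.psiSum k A ρ lam tail t (c • y) = c • N.psiSum k A ρ lam tail t y := by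
  simp only [psiSum, map_smul, smul_sum, smul_comm c]

/-- `ψ` of a finite sum of vectors. [folklore] -/
theorem psiSum_sum {ι : Type*} (A : Equiv.Perm (Fin (minRank δ)) →* (V →ₗ[ℂ] V))
    (ρ : MinImage δ → Equiv.Perm (Fin (minRank δ))) (N : MinImage δ) (lam : ℕ) (tail : List ℕ)
    (t : ℝ) (s : Finset ι) (y : ι → V) :
    N.psiSum k A ρ lam tail t (∑ i ∈ s, y i) = ∑ i ∈ s, N.psiSum k A ρ lam tail t (y i) := by
  classical
  induction s using Finset.induction_on with
  | empty => simp [psiSum]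
  | insert i s hi ih => rw [sum_insert hi, sum_insert hi, psiSum_add_vec, ih]

/-- The trivial bound `‖ψ^N_λ y‖ ≤ k^λ ‖y‖`. [folklore] -/
theorem norm_psiSum_le_triv (A : Equiv.Perm (Fin (minRank δ)) →* (V →ₗ[ℂ] V))
    (hA : ∀ g v, ‖A g v‖ = ‖v‖) (ρ : MinImage δ → Equiv.Perm (Fin (minRank δ))) (N : MinImage δ)
    (lam : ℕ) (tail : List ℕ) (t : ℝ) (y : V) :
    ‖N.psiSum k A ρ lam tail t y‖ ≤ (k : ℝ) ^ lam * ‖y‖ := by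
  refine (norm_sum_le _ _).trans ?_
  have : ∀ u ∈ range (k ^ lam),
      ‖((𝐞 (-((u : ℝ) * t)) : Circle) : ℂ) • A (N.Tρ ρ (msbBlock k lam u ++ tail)) y‖ = ‖y‖ := by
    intro u _; rw [norm_smul, norm_fourierChar_coe, one_mul, hA]
  rw [sum_congr rfl this, sum_const, card_range, nsmul_eq_mul]
  push_cast
  rfl

/-! ## Lemma 4.7: the recursion -/

/-- **Müllner's Lemma 4.7** (distinguishing the `m` most significant digits):
`ψ^N_{m+λ'}(tail,t) y = ∑_{ε<k^m} e(−ε k^{λ'} t) ψ^{δ(N,(ε)_k^m)}_{λ'}(tail,t) (A(T̄(N,(ε)_k^m)) y)`.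
[cite: Mullner2017, Lemma 4.7] -/
theorem psiSum_add (hk : 2 ≤ k) (A : Equiv.Perm (Fin (minRank δ)) →* (V →ₗ[ℂ] V))
    (ρ : MinImage δ → Equiv.Perm (Fin (minRank δ))) (N : MinImage δ) (m lam' : ℕ) (tail : List ℕ)
    (t : ℝ) (y : V) :
    N.psiSum k A ρ (m + lam') tail t y = ∑ ε ∈ range (k ^ m),
      ((𝐞 (-((ε : ℝ) * k ^ lam' * t)) : Circle) : ℂ) •
        (N.next (msbBlock k m ε)).psiSum k A ρ lam' tail t (A (N.Tρ ρ (msbBlock k m ε)) y) := by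
  have hk1 : 1 < k := hk
  rw [psiSum, pow_add, sum_range_mul_blocks]
  refine sum_congr rfl fun ε hε => ?_
  rw [psiSum, smul_sum]
  refine sum_congr rfl fun c hc => ?_
  have hεlt := mem_range.1 hε
  have hclt := mem_range.1 hc
  rw [show ε * k ^ lam' + c = k ^ lam' * ε + c by ring, msbBlock_add hk1 hεlt hclt, List.append_assoc,
    Tρ_append, ← Equiv.Perm.mul_def, map_mul, Module.End.mul_apply, smul_smul, ← fourierChar_coe_add]
  congr 2
  push_cast
  ring

/-! ## Prop. 4.6 / Thm. 4.5: exponential decay on good vectors -/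

/-- The loop part of the recursion is `ψ` of the loop sum. [folklore] -/
theorem sum_loopBlock_eq_psiSum_loopSum (A : Equiv.Perm (Fin (minRank δ)) →* (V →ₗ[ℂ] V))
    (ρ : MinImage δ → Equiv.Perm (Fin (minRank δ))) (N : MinImage δ) (m lam' : ℕ) (tail : List ℕ)
    (t : ℝ) (y : V) :
    ∑ ε ∈ loopBlock k m N, ((𝐞 (-((ε : ℝ) * k ^ lam' * t)) : Circle) : ℂ) •
        (N.next (msbBlock k m ε)).psiSum k A ρ lam' tail t (A (N.Tρ ρ (msbBlock k m ε)) y) =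
      N.psiSum k A ρ lam' tail t (N.loopSum k m A ρ ((k : ℝ) ^ lam' * t) y) := by
  rw [loopSum, psiSum_sum]
  refine sum_congr rfl fun ε hε => ?_
  rw [(mem_loopBlock.1 hε).2, psiSum_smul]
  congr 3
  ring

/-- **Prop. 4.6 (the contraction iterated)**: with `m, η` from `exists_loopSum_contraction`,
`‖ψ^N_{mj+r}(tail,t) y‖ ≤ k^{mj+r} (1 − η/k^m)^j ‖y‖` for every state `N`, suffix `tail`,
real `t` and `y ∈ goodSubspace N`. [cite: Mullner2017, Prop. 4.6 / Lemma 4.8 ("the statement follows easily")] -/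
theorem norm_psiSum_le_pow (hk : 2 ≤ k) (htriv : ∀ q d, k ≤ d → δ q d = q)
    [NeZero (transducerDPrime hk δ htriv)] (hd : transducerPeriod k δ = 1)
    (hk0 : transducerK0 hk δ htriv = 1) (A : Equiv.Perm (Fin (minRank δ)) →* (V →ₗ[ℂ] V))
    (hA : ∀ g v, ‖A g v‖ = ‖v‖) (ρ : MinImage δ → Equiv.Perm (Fin (minRank δ))) {m : ℕ} {η : ℝ}
    (hη1 : η ≤ (k : ℝ) ^ m)
    (hgap : ∀ (N : MinImage δ) (t : ℝ) (y : V), y ∈ N.goodSubspace hk htriv A ρ →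
      ‖N.loopSum k m A ρ t y‖ ≤ ((loopBlock k m N).card - η) * ‖y‖)
    (j r : ℕ) (N : MinImage δ) (tail : List ℕ) (t : ℝ) {y : V}
    (hy : y ∈ N.goodSubspace hk htriv A ρ) :
    ‖N.psiSum k A ρ (m * j + r) tail t y‖ ≤
      (k : ℝ) ^ (m * j + r) * (1 - η / (k : ℝ) ^ m) ^ j * ‖y‖ := by
  classical
  have hk1 : 1 < k := hk
  have hkpos : (0 : ℝ) < (k : ℝ) ^ m := by positivity
  induction j generalizing N y with
  | zero =>
    rw [mul_zero, zero_add, pow_zero, mul_one]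
    exact norm_psiSum_le_triv A hA ρ N r tail t y
  | succ j ih =>
    have hsplit : m * (j + 1) + r = m + (m * j + r) := by ring
    rw [hsplit, N.psiSum_add hk A ρ m (m * j + r) tail t y]
    set lam' := m * j + r with hlam'
    set B : ℝ := (k : ℝ) ^ lam' * (1 - η / (k : ℝ) ^ m) ^ j with hB
    have hB0 : 0 ≤ B := by
      have : 0 ≤ 1 - η / (k : ℝ) ^ m := by
        rw [sub_nonneg, div_le_one hkpos]; exact hη1
      positivity
    -- the vectors `y_ε = A(T̄(N,(ε)_k^m)) y` are good at `δ(N, (ε)_k^m)`, of norm `‖y‖`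
    have hgoodε : ∀ ε : ℕ, A (N.Tρ ρ (msbBlock k m ε)) y ∈
        (N.next (msbBlock k m ε)).goodSubspace hk htriv A ρ := fun ε =>
      N.A_Tρ_mem_goodSubspace hk htriv hd hk0 A hA ρ (fun d hd' => lt_of_mem_msbBlock hk1 hd') hy
    -- split the sum over `ε` into loops and non-loops
    rw [← sum_filter_add_sum_filter_not (range (k ^ m)) (fun ε => N.next (msbBlock k m ε) = N)]
    have hW : (range (k ^ m)).filter (fun ε => N.next (msbBlock k m ε) = N) = loopBlock k m N := rfl
    rw [hW, sum_loopBlock_eq_psiSum_loopSum]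
    refine (norm_add_le _ _).trans ?_
    -- the loop part
    have hloopgood : N.loopSum k m A ρ ((k : ℝ) ^ lam' * t) y ∈ N.goodSubspace hk htriv A ρ := by
      refine Submodule.sum_mem _ fun ε hε => Submodule.smul_mem _ _ ?_
      have := hgoodε ε
      rwa [(mem_loopBlock.1 hε).2] at this
    have h1 : ‖N.psiSum k A ρ lam' tail t (N.loopSum k m A ρ ((k : ℝ) ^ lam' * t) y)‖ ≤
        B * (((loopBlock k m N).card - η) * ‖y‖) :=
      (ih N hloopgood).trans (mul_le_mul_of_nonneg_left (hgap N _ y hy) hB0)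
    -- the non-loop part
    have h2 : ‖∑ ε ∈ (range (k ^ m)).filter (fun ε => ¬N.next (msbBlock k m ε) = N),
        ((𝐞 (-((ε : ℝ) * k ^ lam' * t)) : Circle) : ℂ) •
          (N.next (msbBlock k m ε)).psiSum k A ρ lam' tail t (A (N.Tρ ρ (msbBlock k m ε)) y)‖ ≤
        ((k : ℝ) ^ m - (loopBlock k m N).card) * (B * ‖y‖) := by
      refine (norm_sum_le _ _).trans ?_
      have hterm : ∀ ε ∈ (range (k ^ m)).filter (fun ε => ¬N.next (msbBlock k m ε) = N),
          ‖((𝐞 (-((ε : ℝ) * k ^ lam' * t)) : Circle) : ℂ) •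
            (N.next (msbBlock k m ε)).psiSum k A ρ lam' tail t (A (N.Tρ ρ (msbBlock k m ε)) y)‖ ≤
            B * ‖y‖ := by
        intro ε _
        rw [norm_smul, norm_fourierChar_coe, one_mul]
        have := ih (N.next (msbBlock k m ε)) (hgoodε ε)
        rwa [hA] at this
      refine (sum_le_sum hterm).trans ?_
      rw [sum_const, nsmul_eq_mul]
      have hcard : (((range (k ^ m)).filter (fun ε => ¬N.next (msbBlock k m ε) = N)).card : ℝ) =
          (k : ℝ) ^ m - (loopBlock k m N).card := by
        have h := Finset.card_filter_add_card_filter_not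
          (s := range (k ^ m)) (fun ε => N.next (msbBlock k m ε) = N)
        rw [hW, card_range] at h
        have h' : ((loopBlock k m N).card : ℝ) +
            (((range (k ^ m)).filter (fun ε => ¬N.next (msbBlock k m ε) = N)).card : ℝ) = (k : ℝ) ^ m := by
          exact_mod_cast h
        linarith
      rw [hcard]
    refine (add_le_add h1 h2).trans (le_of_eq ?_)
    rw [hB, pow_succ, pow_add]
    field_simp
    ring

/-- **Müllner's Thm. 4.5 / Prop. 4.6 (exponential decay, uniformly)**: there are `C, θ > 0` such
that `‖ψ^N_λ(tail, t) y‖ ≤ C k^λ k^{−θλ} ‖y‖` for every state `N`, every `λ`, suffix `tail`,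
real `t` and `y ∈ goodSubspace N`. [cite: Mullner2017, Thm. 4.5, Prop. 4.6] -/
theorem exists_fourier_decay (hk : 2 ≤ k) (htriv : ∀ q d, k ≤ d → δ q d = q)
    [NeZero (transducerDPrime hk δ htriv)] (hd : transducerPeriod k δ = 1)
    (hk0 : transducerK0 hk δ htriv = 1) (A : Equiv.Perm (Fin (minRank δ)) →* (V →ₗ[ℂ] V))
    (hA : ∀ g v, ‖A g v‖ = ‖v‖) (ρ : MinImage δ → Equiv.Perm (Fin (minRank δ)))
    [FiniteDimensional ℂ V] :
    ∃ C θ : ℝ, 0 < C ∧ 0 < θ ∧ ∀ (N : MinImage δ) (lam : ℕ) (tail : List ℕ) (t : ℝ) (y : V),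
      y ∈ N.goodSubspace hk htriv A ρ →
        ‖N.psiSum k A ρ lam tail t y‖ ≤ C * (k : ℝ) ^ lam * (k : ℝ) ^ (-(θ * lam)) * ‖y‖ := by
  obtain ⟨m, hm0, η, hη0, hη1, hgap⟩ := exists_loopSum_contraction hk htriv hd hk0 A hA ρ
  have hk1 : (1 : ℝ) < k := by exact_mod_cast (hk : 1 < k)
  have hkm : (2 : ℝ) ≤ (k : ℝ) ^ m := by
    calc (2 : ℝ) ≤ k := by exact_mod_cast hk
      _ = (k : ℝ) ^ 1 := (pow_one _).symm
      _ ≤ (k : ℝ) ^ m := pow_le_pow_right₀ hk1.le hm0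
  have hηk : η ≤ (k : ℝ) ^ m := hη1.trans (by linarith)
  set q : ℝ := 1 - η / (k : ℝ) ^ m with hq
  have hq0 : 0 < q := by
    rw [hq, sub_pos, div_lt_one (by positivity)]; linarith
  have hq1 : q < 1 := by
    rw [hq, sub_lt_self_iff]; positivity
  have hq1' : q ≤ 1 := hq1.le
  -- `θ` with `k^{-θ m} = q`, i.e. `θ = -log q / (m log k)`
  set θ : ℝ := -Real.log q / (m * Real.log k) with hθ
  have hlogk : 0 < Real.log k := Real.log_pos hk1
  have hlogq : Real.log q < 0 := Real.log_neg hq0 hq1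
  have hθ0 : 0 < θ := by
    rw [hθ]; exact div_pos (neg_pos.2 hlogq) (mul_pos (by exact_mod_cast hm0) hlogk)
  have hkθ : ∀ x : ℝ, (k : ℝ) ^ (-(θ * x)) = q ^ (x / m) := by
    intro x
    rw [Real.rpow_def_of_pos (by positivity), Real.rpow_def_of_pos hq0]
    congr 1
    rw [hθ]
    field_simp
  refine ⟨q⁻¹, θ, inv_pos.2 hq0, hθ0, fun N lam tail t y hy => ?_⟩
  -- write `lam = m j + r`
  obtain ⟨j, r, hr, rfl⟩ : ∃ j r, r < m ∧ lam = m * j + r :=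
    ⟨lam / m, lam % m, Nat.mod_lt _ hm0, (Nat.div_add_mod lam m).symm⟩
  have h := norm_psiSum_le_pow hk htriv hd hk0 A hA ρ hηk hgap j r N tail t hy
  refine h.trans ?_
  rw [hkθ]
  -- `q^j ≤ q⁻¹ q^{(mj+r)/m}` since `(mj+r)/m ≤ j + 1`
  have hexp : (j : ℝ) ≥ ((m * j + r : ℕ) : ℝ) / m - 1 := by
    rw [ge_iff_le, sub_le_iff_le_add, div_le_iff₀ (by exact_mod_cast hm0)]
    push_cast
    have : (r : ℝ) ≤ m := by exact_mod_cast hr.le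
    nlinarith
  have hqj : q ^ j ≤ q⁻¹ * q ^ (((m * j + r : ℕ) : ℝ) / m) := by
    have e : q⁻¹ * q ^ (((m * j + r : ℕ) : ℝ) / m) = q ^ (((m * j + r : ℕ) : ℝ) / m - 1) := by
      rw [Real.rpow_sub_one hq0.ne']; ring
    rw [e, ← Real.rpow_natCast]
    exact Real.rpow_le_rpow_of_exponent_ge hq0 hq1' hexp
  have hpos : 0 ≤ (k : ℝ) ^ (m * j + r) * ‖y‖ := by positivity
  calc (k : ℝ) ^ (m * j + r) * (1 - η / (k : ℝ) ^ m) ^ j * ‖y‖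
      = q ^ j * ((k : ℝ) ^ (m * j + r) * ‖y‖) := by rw [hq]; ring
    _ ≤ (q⁻¹ * q ^ (((m * j + r : ℕ) : ℝ) / m)) * ((k : ℝ) ^ (m * j + r) * ‖y‖) :=
        mul_le_mul_of_nonneg_right hqj hpos
    _ = q⁻¹ * (k : ℝ) ^ (m * j + r) * q ^ (((m * j + r : ℕ) : ℝ) / m) * ‖y‖ := by ring

/-! ## Def. 4.2 for the transducer read from a zero-stable state -/

/-- From a zero-stable state the padded block followed by `α` zeros reads like the digits of
`u k^α`: `T̄(M, (u)_k^λ 0^α) = T̄(M, (u k^α)_k)` for `u < k^λ`. [folklore] -/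
theorem Tρ_msbBlock_append_replicate (hk : 2 ≤ k) (ρ : MinImage δ → Equiv.Perm (Fin (minRank δ)))
    {M : MinImage δ} (h0 : M.next [0] = M) (h1 : M.T [0] = 1) (lam α : ℕ) {u : ℕ} :
    M.Tρ ρ (msbBlock k lam u ++ List.replicate α 0) = M.Tρ ρ ((Nat.digits k (u * k ^ α)).reverse) := by
  have hk1 : 1 < k := hk
  -- strip the leading zeros of the padded block
  have hstrip : ∀ w : List ℕ, M.Tρ ρ (msbBlock k lam u ++ w) = M.Tρ ρ ((Nat.digits k u).reverse ++ w) := by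
    intro w
    rw [msbBlock, Nat.digitsAppend, List.reverse_append, List.reverse_replicate, List.append_assoc,
      Tρ_append, next_replicate_zero h0, Tρ_eq_conjρ ρ M (next_replicate_zero h0 _),
      T_replicate_zero h0 h1, conjρ_one]
    rfl
  rw [hstrip]
  rcases Nat.eq_zero_or_pos u with rfl | hu
  · -- `u = 0`: both words are runs of zeros
    rw [zero_mul, Nat.digits_zero, List.reverse_nil, List.nil_append,
      Tρ_eq_conjρ ρ M (next_replicate_zero h0 _), T_replicate_zero h0 h1, conjρ_one,
      Tρ_eq_conjρ ρ M M.next_nil, T_nil, conjρ_one]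
  · rw [mul_comm, Nat.digits_base_pow_mul hk1 hu, List.reverse_append, List.reverse_replicate]

/-- **Thm. 4.5 in the form of Def. 4.2** (zero-stable root, no shift): there are `C, θ > 0`
such that for every zero-stable state `M`, every good `y`, all `α, λ` and all real `t`,
`‖∑_{u<k^λ} e(−ut) A(T̄(M, (u k^α)_k)) y‖ ≤ C k^λ k^{−θλ} ‖y‖`.
[cite: Mullner2017, Thm. 4.5 with Def. 4.2] -/
theorem exists_fourier_decay_digits (hk : 2 ≤ k) (htriv : ∀ q d, k ≤ d → δ q d = q)
    [NeZero (transducerDPrime hk δ htriv)] (hd : transducerPeriod k δ = 1)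
    (hk0 : transducerK0 hk δ htriv = 1) (A : Equiv.Perm (Fin (minRank δ)) →* (V →ₗ[ℂ] V))
    (hA : ∀ g v, ‖A g v‖ = ‖v‖) (ρ : MinImage δ → Equiv.Perm (Fin (minRank δ)))
    [FiniteDimensional ℂ V] :
    ∃ C θ : ℝ, 0 < C ∧ 0 < θ ∧ ∀ (M : MinImage δ), M.next [0] = M → M.T [0] = 1 →
      ∀ y ∈ M.goodSubspace hk htriv A ρ, ∀ (α lam : ℕ) (t : ℝ),
        ‖∑ u ∈ range (k ^ lam), ((𝐞 (-((u : ℝ) * t)) : Circle) : ℂ) •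
            A (M.Tρ ρ ((Nat.digits k (u * k ^ α)).reverse)) y‖ ≤
          C * (k : ℝ) ^ lam * (k : ℝ) ^ (-(θ * lam)) * ‖y‖ := by
  obtain ⟨C, θ, hC, hθ, h⟩ := exists_fourier_decay hk htriv hd hk0 A hA ρ
  refine ⟨C, θ, hC, hθ, fun M h0 h1 y hy α lam t => ?_⟩
  have e : ∑ u ∈ range (k ^ lam), ((𝐞 (-((u : ℝ) * t)) : Circle) : ℂ) •
      A (M.Tρ ρ ((Nat.digits k (u * k ^ α)).reverse)) y = M.psiSum k A ρ lam (List.replicate α 0) t y := by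
    refine sum_congr rfl fun u _ => ?_
    rw [Tρ_msbBlock_append_replicate hk ρ h0 h1]
  rw [e]
  exact h M lam _ t y hy

/-- **Thm. 4.5 ⇒ membership in `F_{γ,c}` (Müllner Def. 4.2 / Mauduit–Rivat Def. 2)**: with
`C, θ` as above, for a zero-stable `M` and a good `y` with `‖y‖ ≤ 1`, the `V`-valued sequence
`n ↦ A(T̄(M,(n)_k)) y` has the Fourier property with `γ(λ) = θλ − log_k C` and ANY `c`.
[cite: Mullner2017, Thm. 4.5 ("(def:2) holds … with γ(λ) = η'λ − c'")] -/
theorem hasFourierProperty_Tρ (hk : 2 ≤ k) {htriv : ∀ q d, k ≤ d → δ q d = q}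
    [NeZero (transducerDPrime hk δ htriv)] {A : Equiv.Perm (Fin (minRank δ)) →* (V →ₗ[ℂ] V)}
    {ρ : MinImage δ → Equiv.Perm (Fin (minRank δ))} {C θ : ℝ} (hC : 0 < C)
    (h : ∀ (M : MinImage δ), M.next [0] = M → M.T [0] = 1 →
      ∀ y ∈ M.goodSubspace hk htriv A ρ, ∀ (α lam : ℕ) (t : ℝ),
        ‖∑ u ∈ range (k ^ lam), ((𝐞 (-((u : ℝ) * t)) : Circle) : ℂ) •
            A (M.Tρ ρ ((Nat.digits k (u * k ^ α)).reverse)) y‖ ≤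
          C * (k : ℝ) ^ lam * (k : ℝ) ^ (-(θ * lam)) * ‖y‖)
    {M : MinImage δ} (h0 : M.next [0] = M) (h1 : M.T [0] = 1) {y : V}
    (hy : y ∈ M.goodSubspace hk htriv A ρ) (hy1 : ‖y‖ ≤ 1) (c : ℝ) :
    MauduitRivat.HasFourierProperty k (fun lam => θ * lam - Real.logb k C) c
      (fun n => A (M.Tρ ρ ((Nat.digits k n).reverse)) y) := by
  intro α lam _ t
  have hk1 : (1 : ℝ) < k := by exact_mod_cast (hk : 1 < k)
  have hkpos : (0 : ℝ) < k := by positivity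
  have hklam : (0 : ℝ) < (k : ℝ) ^ lam := by positivity
  have hb := h M h0 h1 y hy α lam t
  rw [norm_smul, norm_inv, Real.norm_eq_abs, abs_of_pos hklam, inv_mul_le_iff₀ hklam]
  refine hb.trans ?_
  -- `C k^λ k^{-θλ} ‖y‖ ≤ k^λ k^{-(θλ − log_k C)}`
  have e : (k : ℝ) ^ (-(θ * lam - Real.logb k C)) = (k : ℝ) ^ (-(θ * lam)) * C := by
    rw [show -(θ * lam - Real.logb k C) = -(θ * lam) + Real.logb k C by ring,
      Real.rpow_add hkpos, Real.rpow_logb hkpos hk1.ne' hC]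
  rw [e]
  calc C * (k : ℝ) ^ lam * (k : ℝ) ^ (-(θ * lam)) * ‖y‖
      ≤ C * (k : ℝ) ^ lam * (k : ℝ) ^ (-(θ * lam)) * 1 := by gcongr
    _ = (k : ℝ) ^ lam * ((k : ℝ) ^ (-(θ * ↑lam)) * C) := by ring

end MinImage

end Literature.NumberTheory.LFunctions
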